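import Mathlib.Analysis.SpecialFunctions.Pow.Complex
import Mathlib.Analysis.SpecialFunctions.Pow.Real
import Literature.Geometry.Lorentzian.Sweep2
import Literature.Geometry.Lorentzian.KerrTimelikeSpan
import HarnessLib

/-!
# Real-axis mode stability for the Teukolsky equation on subextremal Kerr
# (Teixeira da Costa 2020, Thm. 4.1 ⇒ Thm. 1.1) — named fact

Cite item `wi-20459` (routes FinalStateConjecture/GlobalAttraction, items
`stmt-FinalStateConjecture-10043/10044`: the "Kerr Wiener condition" — no real-frequency
outgoing modes). Source read verbatim: R. Teixeira da Costa, *Mode stability for the Teukolsky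
equation on extremal and subextremal Kerr spacetimes*, Commun. Math. Phys. 378 (2020) 705–781 =
arXiv:1910.02854 [Costa2019], materialised pp. 3, 7, 9–11, 31:

* §2.1 (2.1): `r_± := M ± √(M² − a²)`; §2.2.1: `ξ := −i (2Mr₊/(r₊ − r₋)) (ω − m ω₊)`,
  `ω₊ := a/(2Mr₊)`; Def. 2.1 (admissible frequencies): "`m` is admissible with respect to `s`
  when, if `s` is an integer, `m` is also an integer and when, if `s` is a half-integer, so is
  `m`"; "the frequency triple `(ω, m, λ)` is admissible with respect to `s` when `m` is admissible
  with respect to `s` and `(ω, λ) ∈ {Im ω > 0, Im(λ ω̄) < 0} ∪ (ℝ∖{0}) × ℝ`"; "`(ω, m)` is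
  admissible with respect to `a` when, if `|a| = M`, `ω ≠ m ω₊`" (no condition for `|a| < M`).
* §2.2.3, the radial ODE (homogeneous case `F̂ ≡ 0`):
  `Δ^{-s} d/dr (Δ^{s+1} dR/dr) + ([ω(r²+a²) − am]² − 2is(r−M)[ω(r²+a²) − am])/Δ · R`
  `+ (4isωr − λ − a²ω² + 2amω) R = 0`, `Δ = r² − 2Mr + a²`.
* Def. 2.4 (outgoing solution), case `|a| < M`: "`R(r)(r − r₊)^{s−ξ}` is smooth at `r = r₊`" and
  "`R(r) ∼ e^{iωr} r^{2iMω−1−2s}` asymptotically as `r → ∞`", where (footnote to Def. 2.3) "This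
  notation means that there are constants `{c_k}` such that for every `N ≥ 1`,
  `R(r) = e^{iωr + 2iMω log r} ∑_{k=0}^{N} c_k r^{−2s−k−1} + O(r^{−2s−N−2})` for large `r`."
* **Theorem 4.1.** "Fix `M > 0`, `|a| ≤ M` and `s ∈ ½ℤ`. There are no nontrivial outgoing
  solutions to the homogeneous radial ODE (2.x), in the sense of Definition 2.4, for any
  admissible frequency triple `(ω, m, λ)` with respect to `s` and `a` where `ω` is real."
  (p. 31: "Theorems 4.1 and 4.2 do not require `λ` to be a separation constant … for mode
  stability on the real axis, `λ` can take any real value … Hence, Theorems 4.1 and 4.2 imply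
  Theorems 1.1 and 1.2"; **Theorem 1.1**: "There are no non-trivial mode solutions to the
  homogeneous Teukolsky equation of any spin `s ∈ ½ℤ` on subextremal Kerr backgrounds with `ω`
  such that `Im ω ≥ 0` and `ω ≠ 0`", mode solutions being `e^{−iωt} e^{imφ} S(θ) R(r)` with `R`
  outgoing, Def. 2.5.) Earlier: Whiting 1989 (`Im ω > 0`), Shlapentokh-Rothman 2015 (`s = 0`,
  real axis), Andersson–Ma–Paganini–Whiting 2017 (`|s| ≤ 2`, real axis).

## What is vendored (and how)

ONE named fact, `Costa2019_realAxisModeStability`: Theorem 4.1 restricted to the SUBEXTREMAL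
case `|a| < M` (the printed theorem also covers `|a| = M` with different boundary conditions at
`r = M`, not rendered), as the ODE statement it is — every classical solution `R` on `(r₊, ∞)`
of the homogeneous radial Teukolsky ODE (`Kerr.IsRadialTeukolskySolution`, the printed operator
expanded through the identity `Δ^{-s}(Δ^{s+1}R')' = ΔR'' + 2(s+1)(r−M)R'` on `{Δ > 0}`) which is
outgoing at the horizon (`Kerr.IsOutgoingAtHorizon`: `R(r)(r−r₊)^{s−ξ}` extends to a `C^∞`
function on a neighbourhood of `r₊`; complex power of the positive real `r − r₊`) and at
infinity (`Kerr.IsOutgoingAtInfinity`: the footnote's asymptotic expansion, verbatim) VANISHES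
IDENTICALLY on `(r₊, ∞)`, for all `M > 0`, `|a| < M`, `s ∈ ½ℤ`, `m` admissible w.r.t. `s`
(`m − s ∈ ℤ`), real `ω ≠ 0` and any real `λ`. Spins and azimuthal numbers are real numbers
constrained to `½ℤ` (`2s ∈ ℤ`). Over the tree's Kerr vocabulary: `Kerr.rPlus`, `Kerr.rMinus`
(`KerrSchild`), `Kerr.delta` (`Sweep2`), `Kerr.horizonAngularVelocity` (`KerrTimelikeSpan`).
The PDE-level statement over `Kerr.teukolskyOp` (no separated outgoing mode solutions) follows by
Teukolsky's separation (TdC §2.2, Def. 2.5) and is NOT vendored here (no separation infrastructure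
in the tree); consumers wanting it bridge through Def. 2.5.

Sanity (proved): the zero function is a radial solution outgoing at both ends
(`isRadialTeukolskySolution_zero`, `isOutgoingAtHorizon_zero`, `isOutgoingAtInfinity_zero`), so
the conclusion "`R ≡ 0`" is the only content.
-/

noncomputable section

open Complex Set

namespace Literature.Geometry.Lorentzian.Kerr

/-! ### Fixed-frequency data of the radial Teukolsky equation -/

/-- Teixeira da Costa's horizon exponent `ξ := −i · (2Mr₊/(r₊ − r₋)) · (ω − m ω₊)`
(`ω₊ = a/(2Mr₊)` the horizon angular velocity): the outgoing radial solutions behave like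
`(r − r₊)^{ξ − s}` at `r = r₊` (subextremal case). [cite: Costa2019, §2.2.1 (definition of ξ)] -/
def horizonExponent (M a ω m : ℝ) : ℂ :=
  -I * ((2 * M * rPlus M a / (rPlus M a - rMinus M a) * (ω - m * horizonAngularVelocity M a) : ℝ)
    : ℂ)

/-- `K(r) = ω (r² + a²) − a m` (the combination entering the radial potential).
[cite: Costa2019, §2.2.3 (radial ODE)] -/
def radialK (a ω m r : ℝ) : ℝ :=
  ω * (r ^ 2 + a ^ 2) - a * m

/-- **Classical solutions of the homogeneous radial Teukolsky ODE** on `(r₊, ∞)` with spin `s`,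
frequency `ω`, azimuthal number `m` and angular parameter `λ` (TdC (2.x), §2.2.3):
`Δ^{-s} (Δ^{s+1} R')' + ((K² − 2is(r−M)K)/Δ + 4isωr − λ − a²ω² + 2amω) R = 0`,
`K = ω(r²+a²) − am`, `Δ = r² − 2Mr + a²` (`Kerr.delta`), written with the first term expanded as
`Δ R'' + 2(s+1)(r−M) R'` (an identity on `{Δ > 0} = (r₊, ∞)`): `R` is twice differentiable at
every `r > r₊` with derivatives `R'`, `R''` and the equation holds pointwise there.
[cite: Costa2019, §2.2.3 (radial ODE)] -/
def IsRadialTeukolskySolution (M a s ω m lam : ℝ) (R : ℝ → ℂ) : Prop :=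
  ∃ R' R'' : ℝ → ℂ, ∀ r : ℝ, rPlus M a < r →
    HasDerivAt R (R' r) r ∧ HasDerivAt R' (R'' r) r ∧
      (delta M a r : ℂ) * R'' r + 2 * ((s + 1 : ℝ) : ℂ) * ((r - M : ℝ) : ℂ) * R' r +
        ((((radialK a ω m r ^ 2 : ℝ) : ℂ) -
              2 * I * (s : ℂ) * ((r - M : ℝ) : ℂ) * (radialK a ω m r : ℂ)) / (delta M a r : ℂ) +
            4 * I * (s : ℂ) * (ω : ℂ) * (r : ℂ) - (lam : ℂ) - ((a ^ 2 * ω ^ 2 : ℝ) : ℂ) +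
            ((2 * a * m * ω : ℝ) : ℂ)) * R r = 0

/-- **Outgoing boundary condition at the event horizon** (TdC Def. 2.4, case `|a| < M`):
"`R(r)(r − r₊)^{s−ξ}` is smooth at `r = r₊`", i.e. it agrees on `(r₊, r₊ + ε)` with a function
`C^∞` on a neighbourhood of `r₊` (`(r − r₊)^{s−ξ}` the principal complex power of the positive
real `r − r₊`). [cite: Costa2019, Definition 2.4] -/
def IsOutgoingAtHorizon (M a s ω m : ℝ) (R : ℝ → ℂ) : Prop :=
  ∃ ε : ℝ, 0 < ε ∧ ∃ f : ℝ → ℂ, ContDiffOn ℝ ((⊤ : ℕ∞) : WithTop ℕ∞) f (Ioo (rPlus M a - ε) (rPlus M a + ε)) ∧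
    ∀ r ∈ Ioo (rPlus M a) (rPlus M a + ε),
      R r * ((r - rPlus M a : ℝ) : ℂ) ^ ((s : ℂ) - horizonExponent M a ω m) = f r

/-- **Outgoing boundary condition at infinity** (TdC Def. 2.4 with the footnote to Def. 2.3):
"`R(r) ∼ e^{iωr} r^{2iMω−1−2s}` asymptotically as `r → ∞`", meaning "there are constants `{c_k}`
such that for every `N ≥ 1`, `R(r) = e^{iωr + 2iMω log r} ∑_{k=0}^{N} c_k r^{−2s−k−1}
+ O(r^{−2s−N−2})` for large `r`". [cite: Costa2019, Definition 2.4 and footnote to Definition 2.3] -/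
def IsOutgoingAtInfinity (M s ω : ℝ) (R : ℝ → ℂ) : Prop :=
  ∃ c : ℕ → ℂ, ∀ N : ℕ, 1 ≤ N → ∃ C r₀ : ℝ, ∀ r : ℝ, r₀ ≤ r →
    ‖R r - exp (I * ω * r + 2 * I * M * ω * Real.log r) *
        ∑ k ∈ Finset.range (N + 1), c k * ((r ^ (-(2 * s) - (k : ℝ) - 1) : ℝ) : ℂ)‖ ≤
      C * r ^ (-(2 * s) - (N : ℝ) - 2)

/-! ### The theorem (named fact) -/

/-- **Teixeira da Costa 2020, Theorem 4.1 (real-axis mode stability), subextremal case** —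
which implies the real-axis part of her Theorem 1.1 ("There are no non-trivial mode solutions to
the homogeneous Teukolsky equation of any spin `s ∈ ½ℤ` on subextremal Kerr backgrounds with
`ω` such that `Im ω ≥ 0` and `ω ≠ 0`"; Whiting 1989 for `Im ω > 0`, Shlapentokh-Rothman 2015
for `s = 0`, Andersson–Ma–Paganini–Whiting 2017 for `|s| ≤ 2`). As printed (Thm. 4.1): "Fix
`M > 0`, `|a| ≤ M` and `s ∈ ½ℤ`. There are no nontrivial outgoing solutions to the homogeneous
radial ODE, in the sense of Definition 2.4, for any admissible frequency triple `(ω, m, λ)` with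
respect to `s` and `a` where `ω` is real." Rendered for `|a| < M` only: for `M > 0`, `|a| < M`,
`s ∈ ½ℤ` (`2s ∈ ℤ`), `m` admissible with respect to `s` (`m − s ∈ ℤ`), real `ω ≠ 0` and ANY
real `λ`, every classical solution of the homogeneous radial Teukolsky ODE on `(r₊, ∞)` which is
outgoing at `𝓗⁺` and at `𝓘⁺` vanishes identically — in particular there is no real-frequency
mode (no zero of the Wronskian of `R_{𝓗⁺}`, `R_{𝓘⁺}` on `ℝ ∖ {0}`, superradiant range
`0 < ω < m ω₊` and threshold `ω = m ω₊` included). Named fact; users take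
`(h : Costa2019_realAxisModeStability)`. [cite: Costa2019, Theorem 4.1 and Theorem 1.1] -/
def Costa2019_realAxisModeStability : Prop :=
  ∀ (M a s ω m lam : ℝ), 0 < M → |a| < M → (∃ k : ℤ, 2 * s = k) → (∃ k : ℤ, m - s = k) →
    ω ≠ 0 → ∀ R : ℝ → ℂ, IsRadialTeukolskySolution M a s ω m lam R →
      IsOutgoingAtHorizon M a s ω m R → IsOutgoingAtInfinity M s ω R →
        ∀ r : ℝ, rPlus M a < r → R r = 0

/-! ### Sanity: the zero function is an outgoing radial solution -/

/-- The zero function solves the homogeneous radial Teukolsky ODE. [folklore] -/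
theorem isRadialTeukolskySolution_zero (M a s ω m lam : ℝ) :
    IsRadialTeukolskySolution M a s ω m lam (fun _ => 0) := by
  refine ⟨fun _ => 0, fun _ => 0, fun r _ => ⟨hasDerivAt_const r 0, hasDerivAt_const r 0, ?_⟩⟩
  simp

/-- The zero function is outgoing at the horizon (with the zero extension). [folklore] -/
theorem isOutgoingAtHorizon_zero (M a s ω m : ℝ) : IsOutgoingAtHorizon M a s ω m (fun _ => 0) :=
  ⟨1, one_pos, fun _ => 0, contDiffOn_const, fun r _ => by simp⟩

/-- The zero function is outgoing at infinity (all `c_k = 0`). [folklore] -/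
theorem isOutgoingAtInfinity_zero (M s ω : ℝ) : IsOutgoingAtInfinity M s ω (fun _ => 0) := by
  refine ⟨fun _ => 0, fun N _ => ⟨0, 1, fun r _ => ?_⟩⟩
  simp

/-- For the zero function the conclusion of the fact holds trivially (shape check). [folklore] -/
theorem Costa2019_realAxisModeStability.apply_zero (M a : ℝ) :
    ∀ r : ℝ, rPlus M a < r → (fun _ : ℝ => (0 : ℂ)) r = 0 :=
  fun _ _ => rfl

end Literature.Geometry.Lorentzian.Kerr

end
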